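import Mathlib.AlgebraicGeometry.Morphisms.ClosedImmersion
import Mathlib.AlgebraicGeometry.Morphisms.FiniteType
import Mathlib.AlgebraicGeometry.Noetherian
import Mathlib.RingTheory.Filtration
import Mathlib.Topology.JacobsonSpace
import HarnessLib

/-!
# A closed immersion through which every infinitesimal neighbourhood of every (closed) point factors is an isomorphism
# (Krull's intersection theorem [Atiyah–Macdonald Cor. 10.20] + the ideal sheaf of a closed immersion [Hartshorne II.5.9])

Topic `Literature/AlgebraicGeometry/Morphisms`, namespace `Literature.AlgebraicGeometry.Morphisms`.  THEOREMS ONLY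
(no definition, no named fact, no `sorry`), Mathlib-only imports.  Cell `hodgecm-mathlib`, banked generic leaf
(road (4M) step (iv) of the U-a3 residual census `B-plan/memo/U-a3-ROAD-M13.md`; no floor change).

Let `i : Γ ⟶ T` be a morphism of schemes and, for a point `t ∈ T` and `n : ℕ`, let
`θ_{t,n} : Spec(𝒪_{T,t}/𝔪_t^{n+1}) → Spec 𝒪_{T,t} → T` be the `n`-th infinitesimal neighbourhood of `t` in `T`
(spelt `Spec.map (CommRingCat.ofHom (Ideal.Quotient.mk (𝔪_t ^ (n+1)))) ≫ T.fromSpecStalk t` — token-identical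
to ★ `Literature.AlgebraicGeometry.Motives.thickeningPtι_left`).  Say that `θ_{t,n}` FACTORS THROUGH `i` if
`θ_{t,n} = s ≫ i` for some `s`.

* `germ_mem_pow_maximalIdeal_of_app_eq_zero` — if `θ_{t,n}` factors through `i`, every section `a ∈ Γ(T, U)`
  (`t ∈ U`) killed by `i` (`i^♯ a = 0`) has its germ at `t` in `𝔪_t^{n+1}`: indeed
  `𝒪_{T,t} → 𝒪_{T,t}/𝔪_t^{n+1}` is the stalk map of `θ_{t,n}` (Mathlib
  `Scheme.germ_stalkClosedPointTo_Spec_fromSpecStalk`), which factors through `i^♯`.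
* `germ_eq_zero_of_app_eq_zero` — hence if `θ_{t,n}` factors through `i` for ALL `n` and `𝒪_{T,t}` is Noetherian
  (`T` locally Noetherian), the germ of such an `a` at `t` lies in `⋂ₙ 𝔪_tⁿ = 0` (Krull's intersection theorem,
  Mathlib `Ideal.iInf_pow_eq_bot_of_isLocalRing`).
* `app_injective_of_forall_factor`, `ker_eq_bot_of_forall_factor`, `isIso_of_isClosedImmersion_of_forall_factor` —
  for `T` locally Noetherian, if ALL `θ_{t,n}` (`t ∈ T`, `n ∈ ℕ`) factor through `i`, then every `i.app U` is
  injective (sheaf axiom), `i.ker = ⊥`, and if `i` is a closed immersion it is an isomorphism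
  (Mathlib `IsClosedImmersion.isIso_iff_ker_eq_bot`).
* `isOpen_setOf_germ_eq_zero`, `eq_zero_of_forall_isClosed_germ_eq_zero` — on a JACOBSON space `T`, a section
  whose germs vanish at all CLOSED points of `T` in `U` vanishes (its non-vanishing locus is locally closed and misses
  the closed points).
* `app_injective_of_forall_isClosed_factor`, `ker_eq_bot_of_forall_isClosed_factor`,
  `isIso_of_isClosedImmersion_of_forall_isClosed_factor` — the same three conclusions for `T` locally Noetherian AND
  Jacobson when only the `θ_{t,n}` at CLOSED points `t` are assumed to factor; and the form used over a field:
  `isIso_of_isClosedImmersion_of_forall_isClosed_factor_of_locallyOfFiniteType` (`T` locally of finite type over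
  a Noetherian Jacobson affine base, e.g. `Spec` of a field), `isIso_left_of_forall_isClosed_factor` (`Over` form).

This is the scheme-theoretic content of «a closed subscheme `Γ ⊆ T` containing all infinitesimal neighbourhoods of all
closed points of a Noetherian Jacobson scheme `T` is `T`», the last step of the Artinian road to representability
statements (e.g. [Mumford, *Abelian Varieties*, §13]; [Görtz–Wedhorn II, proof of Thm. 27.203]): once the comparison map is
a closed immersion, bijectivity on Artinian points gives the factorisations.  What is deliberately NOT here: any
flatness / `Etale` statement (the infinitesimal criterion for étaleness, EGA IV₄ 17.14.2, is not needed on this road).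

## References
* M. F. Atiyah, I. G. Macdonald, *Introduction to Commutative Algebra* (1969), Thm. 10.17 and Cor. 10.20, p. 110
  (Krull's intersection theorem: the `𝔪`-adic topology of a Noetherian local ring is Hausdorff). [AtiyahMacdonald1969]
* R. Hartshorne, *Algebraic Geometry* (1977), Ch. II, Prop. 5.9 (p. 116: closed subschemes ↔ quasi-coherent ideal
  sheaves) and Exercise 1.14 (p. 67: the support of a section is closed). [Hartshorne1977]
* U. Görtz, T. Wedhorn, *Algebraic Geometry I* (2nd ed., 2020), Def./Rem. 3.34 (very dense subsets: every non-empty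
  locally closed subset meets them) and Prop. 3.35 (closed points of a scheme locally of finite type over a field are
  very dense). [GortzWedhorn2020]
* The Stacks Project, Tag 00IP (Krull's intersection theorem). [StacksProject]
* U. Görtz, T. Wedhorn, *Algebraic Geometry II* (2023), proof of Thm. 27.203 (the Artinian road); D. Mumford, *Abelian
  Varieties* (1970), §13 (where the factorisations come from in the application). [GortzWedhorn2023] [MumfordAV1970]
-/

set_option autoImplicit false

universe u

open CategoryTheory CategoryTheory.Limits AlgebraicGeometry TopologicalSpace IsLocalRing

namespace Literature.AlgebraicGeometry.Morphisms

variable {Γ T : Scheme.{u}} (i : Γ ⟶ T)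

/-! ### §1 One infinitesimal neighbourhood: germs killed by `i` lie in `𝔪_t^{n+1}` -/

/-- `𝔪^{n+1} ≠ ⊤` in a local ring. [folklore] -/
private theorem pow_maximalIdeal_ne_top (R : Type*) [CommRing R] [IsLocalRing R] (n : ℕ) :
    maximalIdeal R ^ (n + 1) ≠ ⊤ :=
  fun h => (maximalIdeal.isMaximal R).ne_top (top_le_iff.mp (h ▸ Ideal.pow_le_self (Nat.succ_ne_zero n)))

/-- The quotient `R/𝔪^{n+1}` of a local ring is non-trivial. [folklore] -/
private theorem nontrivial_quotient_pow_maximalIdeal (R : Type*) [CommRing R] [IsLocalRing R] (n : ℕ) :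
    Nontrivial (R ⧸ maximalIdeal R ^ (n + 1)) :=
  Ideal.Quotient.nontrivial_iff.mpr (pow_maximalIdeal_ne_top R n)

/-- The quotient `R/𝔪^{n+1}` of a local ring is a local ring. [folklore] -/
private theorem isLocalRing_quotient_pow_maximalIdeal (R : Type*) [CommRing R] [IsLocalRing R] (n : ℕ) :
    IsLocalRing (R ⧸ maximalIdeal R ^ (n + 1)) :=
  haveI := nontrivial_quotient_pow_maximalIdeal R n
  IsLocalRing.of_surjective' (Ideal.Quotient.mk _) Ideal.Quotient.mk_surjective

/-- The quotient map `R → R/𝔪^{n+1}` of a local ring is a local homomorphism. [folklore] -/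
private theorem isLocalHom_mk_pow_maximalIdeal (R : Type*) [CommRing R] [IsLocalRing R] (n : ℕ) :
    IsLocalHom (Ideal.Quotient.mk (maximalIdeal R ^ (n + 1))) :=
  haveI := nontrivial_quotient_pow_maximalIdeal R n
  IsLocalHom.of_surjective _ Ideal.Quotient.mk_surjective

/-- **Sections killed by `i` die in the local ring of any `Spec`-of-a-local-ring point that factors through `i`.**
Let `θ : Spec A ⟶ T` (`A` local, closed point `ξ`) factor as `θ = s ≫ i`.  Then for every open `U ∋ θ(ξ)` and every
`a ∈ Γ(T, U)` with `i^♯(a) = 0`, the image of `a` under `Γ(T,U) → 𝒪_{T,θ ξ} → A` (Mathlib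
`Scheme.stalkClosedPointTo θ`) vanishes: that map is `Γ(T,U) → Γ(Γ, i⁻¹U) → Γ(Spec A, ⊤) → A` (Mathlib
`Scheme.Hom.germ_stalkMap` for `s ≫ i`). [cite: Hartshorne1977, Ch. II, Prop. 5.9 (p. 116)] -/
theorem germ_stalkClosedPointTo_apply_eq_zero_of_factor {A : CommRingCat.{u}} [IsLocalRing A]
    (θ : Spec A ⟶ T) (s : Spec A ⟶ Γ) (hs : s ≫ i = θ) {U : T.Opens} (hU : θ (closedPoint A) ∈ U)
    (a : Γ(T, U)) (ha : i.app U a = 0) :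
    (T.presheaf.germ U _ hU ≫ Scheme.stalkClosedPointTo θ) a = 0 := by
  subst hs
  have e := Scheme.Hom.germ_stalkMap (s ≫ i) U (closedPoint A) hU
  unfold Scheme.stalkClosedPointTo
  rw [← Category.assoc, e]
  change (stalkClosedPointIso A).hom ((Spec A).presheaf.germ _ _ hU (s.app _ (i.app U a))) = 0
  rw [ha, map_zero, map_zero, map_zero]

/-- **Germs killed by `i` lie in `𝔪_t^{n+1}` when the `n`-th infinitesimal neighbourhood of `t` factors through `i`.**
Let `i : Γ ⟶ T`, `t ∈ T`, and suppose `Spec(𝒪_{T,t}/𝔪_t^{n+1}) → T` factors as `s ≫ i`.  Then for every open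
`U ∋ t` and every `a ∈ Γ(T, U)` with `i^♯(a) = 0 ∈ Γ(Γ, i⁻¹U)`, the germ `a_t` lies in `𝔪_t^{n+1}`: the composite
`Γ(T,U) → 𝒪_{T,t} → 𝒪_{T,t}/𝔪_t^{n+1}` is `Γ(T,U) → 𝒪_{T, θ(ξ)} → 𝒪_{T,t}/𝔪_t^{n+1}` for the closed point `ξ` of
the thickening (Mathlib `Scheme.germ_stalkClosedPointTo_Spec_fromSpecStalk`), which kills `a`
(`germ_stalkClosedPointTo_apply_eq_zero_of_factor`). [cite: Hartshorne1977, Ch. II, Prop. 5.9 (p. 116)] -/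
theorem germ_mem_pow_maximalIdeal_of_app_eq_zero {t : T} {n : ℕ}
    (s : Spec (.of (↑(T.presheaf.stalk t) ⧸ maximalIdeal ↑(T.presheaf.stalk t) ^ (n + 1))) ⟶ Γ)
    (hs : s ≫ i = Spec.map (CommRingCat.ofHom (Ideal.Quotient.mk
      (maximalIdeal ↑(T.presheaf.stalk t) ^ (n + 1)))) ≫ T.fromSpecStalk t)
    {U : T.Opens} (htU : t ∈ U) (a : Γ(T, U)) (ha : i.app U a = 0) :
    T.presheaf.germ U t htU a ∈ maximalIdeal ↑(T.presheaf.stalk t) ^ (n + 1) := by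
  haveI : IsLocalRing ↑(CommRingCat.of
      (↑(T.presheaf.stalk t) ⧸ maximalIdeal ↑(T.presheaf.stalk t) ^ (n + 1))) :=
    isLocalRing_quotient_pow_maximalIdeal _ n
  haveI : IsLocalHom (CommRingCat.ofHom (Ideal.Quotient.mk
      (maximalIdeal ↑(T.presheaf.stalk t) ^ (n + 1)))).hom :=
    isLocalHom_mk_pow_maximalIdeal _ n
  -- the closed point of the thickening goes to `t`
  have hpt : (Spec.map (CommRingCat.ofHom (Ideal.Quotient.mk
      (maximalIdeal ↑(T.presheaf.stalk t) ^ (n + 1)))) ≫ T.fromSpecStalk t) (closedPoint _) = t := by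
    rw [Scheme.Hom.comp_apply, Spec_closedPoint, Scheme.fromSpecStalk_closedPoint]
  have hU : (Spec.map (CommRingCat.ofHom (Ideal.Quotient.mk
      (maximalIdeal ↑(T.presheaf.stalk t) ^ (n + 1)))) ≫ T.fromSpecStalk t) (closedPoint _) ∈ U := by
    rw [hpt]; exact htU
  have e := Scheme.germ_stalkClosedPointTo_Spec_fromSpecStalk (X := T)
    (CommRingCat.ofHom (Ideal.Quotient.mk (maximalIdeal ↑(T.presheaf.stalk t) ^ (n + 1)))) U hU
  have e' := germ_stalkClosedPointTo_apply_eq_zero_of_factor i _ s hs hU a ha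
  have e'' : (T.presheaf.germ U t htU ≫ CommRingCat.ofHom (Ideal.Quotient.mk
      (maximalIdeal ↑(T.presheaf.stalk t) ^ (n + 1)))) a = 0 :=
    (congrArg (fun f => (ConcreteCategory.hom f) a) e).symm.trans e'
  exact Ideal.Quotient.eq_zero_iff_mem.mp e''

/-! ### §2 All infinitesimal neighbourhoods of a point: germs killed by `i` vanish (Krull) -/

/-- **Krull.** If ALL infinitesimal neighbourhoods `Spec(𝒪_{T,t}/𝔪_t^{n+1}) → T` (`n ∈ ℕ`) of `t` factor through
`i : Γ ⟶ T` and `𝒪_{T,t}` is Noetherian, then every `a ∈ Γ(T,U)` (`t ∈ U`) with `i^♯(a) = 0` has `a_t = 0`: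
`a_t ∈ ⋂ₙ 𝔪_tⁿ = 0` by Krull's intersection theorem (Mathlib `Ideal.iInf_pow_eq_bot_of_isLocalRing`).
[cite: AtiyahMacdonald1969, Cor. 10.20 (p. 110)] [cite: StacksProject, Tag 00IP] -/
theorem germ_eq_zero_of_app_eq_zero {t : T} [IsNoetherianRing ↑(T.presheaf.stalk t)]
    (h : ∀ n : ℕ, ∃ s : Spec (.of (↑(T.presheaf.stalk t) ⧸ maximalIdeal ↑(T.presheaf.stalk t) ^ (n + 1))) ⟶ Γ,
      s ≫ i = Spec.map (CommRingCat.ofHom (Ideal.Quotient.mk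
        (maximalIdeal ↑(T.presheaf.stalk t) ^ (n + 1)))) ≫ T.fromSpecStalk t)
    {U : T.Opens} (htU : t ∈ U) (a : Γ(T, U)) (ha : i.app U a = 0) :
    T.presheaf.germ U t htU a = 0 := by
  have hmem : T.presheaf.germ U t htU a ∈ ⨅ n : ℕ, maximalIdeal ↑(T.presheaf.stalk t) ^ n := by
    refine Ideal.mem_iInf.mpr fun n => ?_
    cases n with
    | zero => simp
    | succ n =>
      obtain ⟨s, hs⟩ := h n
      exact germ_mem_pow_maximalIdeal_of_app_eq_zero i s hs htU a ha
  rwa [Ideal.iInf_pow_eq_bot_of_isLocalRing _ (maximalIdeal.isMaximal _).ne_top, Ideal.mem_bot] at hmem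

/-! ### §3 Locally Noetherian target, all points: injectivity of `i^♯`, `ker i = 0`, isomorphism -/

section AllPoints

variable [IsLocallyNoetherian T]
  (h : ∀ (t : T) (n : ℕ),
    ∃ s : Spec (.of (↑(T.presheaf.stalk t) ⧸ maximalIdeal ↑(T.presheaf.stalk t) ^ (n + 1))) ⟶ Γ,
      s ≫ i = Spec.map (CommRingCat.ofHom (Ideal.Quotient.mk
        (maximalIdeal ↑(T.presheaf.stalk t) ^ (n + 1)))) ≫ T.fromSpecStalk t)
include h

/-- **`i^♯` is injective on every open** when `T` is locally Noetherian and all infinitesimal neighbourhoods of all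
points of `T` factor through `i : Γ ⟶ T`: a section killed by `i^♯` has all its germs zero
(`germ_eq_zero_of_app_eq_zero`), hence is zero by the sheaf axiom. [cite: AtiyahMacdonald1969, Cor. 10.20 (p. 110)] -/
theorem app_injective_of_forall_factor (U : T.Opens) : Function.Injective (i.app U) := by
  refine (injective_iff_map_eq_zero _).mpr fun a ha => ?_
  refine TopCat.Presheaf.section_ext T.sheaf U a 0 fun x hx => ?_
  change T.presheaf.germ U x hx a = T.presheaf.germ U x hx 0
  rw [map_zero]
  exact germ_eq_zero_of_app_eq_zero i (h x) hx a ha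

/-- **The kernel ideal sheaf of `i` vanishes** under the same hypotheses (Mathlib `Scheme.Hom.ker`, the largest
quasi-coherent ideal contained in the componentwise kernels `ker i^♯(U)`, all of which are zero).
[cite: Hartshorne1977, Ch. II, Prop. 5.9 (p. 116)] -/
theorem ker_eq_bot_of_forall_factor : i.ker = ⊥ := by
  refine le_bot_iff.mp (Scheme.IdealSheafData.le_def.mpr fun U => ?_)
  refine (i.ideal_ker_le U).trans ?_
  rw [(RingHom.injective_iff_ker_eq_bot _).mp (app_injective_of_forall_factor i h U.1)]
  exact le_rfl

/-- **A closed immersion through which all infinitesimal neighbourhoods of all points of a locally Noetherian scheme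
factor is an isomorphism**: `ker i = 0` (`ker_eq_bot_of_forall_factor`) and Mathlib
`IsClosedImmersion.isIso_iff_ker_eq_bot`. [cite: Hartshorne1977, Ch. II, Prop. 5.9 (p. 116)]
[cite: AtiyahMacdonald1969, Cor. 10.20 (p. 110)] -/
theorem isIso_of_isClosedImmersion_of_forall_factor [IsClosedImmersion i] : IsIso i :=
  IsClosedImmersion.isIso_iff_ker_eq_bot.mpr (ker_eq_bot_of_forall_factor i h)

end AllPoints

/-! ### §4 Sections vanishing at the closed points of a Jacobson space vanish -/

/-- The locus of points of `U` where the germ of a section `a ∈ Γ(T,U)` VANISHES is open (a germ is zero iff the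
section restricts to zero on a neighbourhood, Mathlib `TopCat.Presheaf.germ_eq`); equivalently the support of a section
is closed. [cite: Hartshorne1977, Ch. II, Exercise 1.14 (p. 67)] -/
theorem isOpen_setOf_germ_eq_zero {U : T.Opens} (a : Γ(T, U)) :
    IsOpen {x : T | ∃ hx : x ∈ U, T.presheaf.germ U x hx a = 0} := by
  refine isOpen_iff_forall_mem_open.mpr ?_
  rintro x ⟨hxU, hx⟩
  have hx' : T.presheaf.germ U x hxU a = T.presheaf.germ U x hxU 0 := by rw [hx, map_zero]
  obtain ⟨W, hxW, iWU, iWU', hW⟩ := T.presheaf.germ_eq x hxU hxU a 0 hx'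
  refine ⟨W, fun y hy => ⟨iWU.le hy, ?_⟩, W.2, hxW⟩
  rw [← T.presheaf.germ_res_apply iWU y hy a, hW, map_zero, map_zero]

/-- **On a Jacobson space, a section whose germs vanish at all closed points vanishes**: the non-vanishing locus of
`a ∈ Γ(T,U)` is locally closed in `T` (closed in the open `U`, by `isOpen_setOf_germ_eq_zero`); if non-empty it
contains a closed point of `T` (Mathlib `nonempty_inter_closedPoints`), contradiction; so all germs vanish and `a = 0`
by the sheaf axiom. [cite: GortzWedhorn2020, Def./Rem. 3.34 and Prop. 3.35] [cite: Hartshorne1977, Ch. II, Exercise 1.14 (p. 67)] -/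
theorem eq_zero_of_forall_isClosed_germ_eq_zero [JacobsonSpace ↥T] {U : T.Opens} (a : Γ(T, U))
    (ha : ∀ (x : T) (hx : x ∈ U), IsClosed ({x} : Set T) → T.presheaf.germ U x hx a = 0) : a = 0 := by
  refine TopCat.Presheaf.section_ext T.sheaf U a 0 fun x hx => ?_
  change T.presheaf.germ U x hx a = T.presheaf.germ U x hx 0
  rw [map_zero]
  by_contra hne
  -- the non-vanishing locus `Z ⊆ U` is locally closed and non-empty
  set Z : Set T := (U : Set T) ∩ {y : T | ∃ hy : y ∈ U, T.presheaf.germ U y hy a = 0}ᶜ with hZ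
  have hZlc : IsLocallyClosed Z :=
    (U.2.isLocallyClosed).inter (isOpen_setOf_germ_eq_zero a).isClosed_compl.isLocallyClosed
  have hZne : Z.Nonempty := ⟨x, hx, fun ⟨hx', h0⟩ => hne h0⟩
  obtain ⟨y, ⟨hyU, hy⟩, hycl⟩ := nonempty_inter_closedPoints hZne hZlc
  exact hy ⟨hyU, ha y hyU hycl⟩

/-! ### §5 Locally Noetherian Jacobson target, closed points only -/

section ClosedPoints

variable [IsLocallyNoetherian T] [JacobsonSpace ↥T]
  (h : ∀ (t : T), IsClosed ({t} : Set T) → ∀ (n : ℕ),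
    ∃ s : Spec (.of (↑(T.presheaf.stalk t) ⧸ maximalIdeal ↑(T.presheaf.stalk t) ^ (n + 1))) ⟶ Γ,
      s ≫ i = Spec.map (CommRingCat.ofHom (Ideal.Quotient.mk
        (maximalIdeal ↑(T.presheaf.stalk t) ^ (n + 1)))) ≫ T.fromSpecStalk t)
include h

/-- **`i^♯` is injective on every open** when `T` is locally Noetherian and Jacobson (e.g. locally of finite type
over a field) and all infinitesimal neighbourhoods of all CLOSED points factor through `i`: germs of a section killed
by `i^♯` vanish at the closed points (`germ_eq_zero_of_app_eq_zero`), hence the section vanishes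
(`eq_zero_of_forall_isClosed_germ_eq_zero`). [cite: AtiyahMacdonald1969, Cor. 10.20 (p. 110)]
[cite: GortzWedhorn2020, Def./Rem. 3.34] -/
theorem app_injective_of_forall_isClosed_factor (U : T.Opens) : Function.Injective (i.app U) := by
  refine (injective_iff_map_eq_zero _).mpr fun a ha => ?_
  exact eq_zero_of_forall_isClosed_germ_eq_zero a fun x hx hxc =>
    germ_eq_zero_of_app_eq_zero i (h x hxc) hx a ha

/-- **The kernel ideal sheaf of `i` vanishes** under the same (closed-point) hypotheses.
[cite: Hartshorne1977, Ch. II, Prop. 5.9 (p. 116)] -/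
theorem ker_eq_bot_of_forall_isClosed_factor : i.ker = ⊥ := by
  refine le_bot_iff.mp (Scheme.IdealSheafData.le_def.mpr fun U => ?_)
  refine (i.ideal_ker_le U).trans ?_
  rw [(RingHom.injective_iff_ker_eq_bot _).mp (app_injective_of_forall_isClosed_factor i h U.1)]
  exact le_rfl

/-- **A closed immersion through which all infinitesimal neighbourhoods of all CLOSED points of a locally Noetherian
Jacobson scheme factor is an isomorphism** (`ker i = 0` and Mathlib `IsClosedImmersion.isIso_iff_ker_eq_bot`).  This is
the form used on the Artinian road to representability: `T` of finite type over a field, `Γ ↪ T` the closed comparison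
subscheme, factorisations supplied pointwise by a deformation argument. [cite: Hartshorne1977, Ch. II, Prop. 5.9 (p. 116)]
[cite: AtiyahMacdonald1969, Cor. 10.20 (p. 110)] [cite: GortzWedhorn2020, Def./Rem. 3.34] -/
theorem isIso_of_isClosedImmersion_of_forall_isClosed_factor [IsClosedImmersion i] : IsIso i :=
  IsClosedImmersion.isIso_iff_ker_eq_bot.mpr (ker_eq_bot_of_forall_isClosed_factor i h)

end ClosedPoints

/-! ### §6 The forms used over a field / in the `Over` category -/

/-- **Over a Noetherian Jacobson affine base** (e.g. `S = Spec K`, `K` a field): if `T → Spec R` is locally of finite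
type with `R` Noetherian and Jacobson, then `T` is locally Noetherian (Mathlib `LocallyOfFiniteType.isLocallyNoetherian`)
and Jacobson (Mathlib `LocallyOfFiniteType.jacobsonSpace`), so a closed immersion `i : Γ ⟶ T` through which all
infinitesimal neighbourhoods of all closed points of `T` factor is an isomorphism.
[cite: GortzWedhorn2020, Prop. 3.35] [cite: Hartshorne1977, Ch. II, Prop. 5.9 (p. 116)] -/
theorem isIso_of_isClosedImmersion_of_forall_isClosed_factor_of_locallyOfFiniteType
    {R : CommRingCat.{u}} [IsNoetherianRing R] [IsJacobsonRing R] (p : T ⟶ Spec R) [LocallyOfFiniteType p]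
    [IsClosedImmersion i]
    (h : ∀ (t : T), IsClosed ({t} : Set T) → ∀ (n : ℕ),
      ∃ s : Spec (.of (↑(T.presheaf.stalk t) ⧸ maximalIdeal ↑(T.presheaf.stalk t) ^ (n + 1))) ⟶ Γ,
        s ≫ i = Spec.map (CommRingCat.ofHom (Ideal.Quotient.mk
          (maximalIdeal ↑(T.presheaf.stalk t) ^ (n + 1)))) ≫ T.fromSpecStalk t) :
    IsIso i :=
  haveI : IsLocallyNoetherian T := LocallyOfFiniteType.isLocallyNoetherian p
  haveI : JacobsonSpace ↥T := LocallyOfFiniteType.jacobsonSpace p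
  isIso_of_isClosedImmersion_of_forall_isClosed_factor i h

/-- **`Over` form.** For `Γ T : Over (Spec R)` (`R` Noetherian Jacobson, e.g. a field; `T` locally of finite type) and
`i : Γ ⟶ T` with `i.left` a closed immersion: if for every closed point `t` of `T` and every `n` there is
`s : Spec(𝒪_{T,t}/𝔪_t^{n+1}) ⟶ Γ.left` with `s ≫ i.left = Spec(𝒪_{T,t}/𝔪_t^{n+1}) → T` — for the tree's
`thickeningPtι T t n : thickeningPt T t n ⟶ T` this is `s := σ.left` for a factorisation `σ ≫ i = thickeningPtι T t n`
in the `Over` category, by `Over.comp_left` and ★ `thickeningPtι_left` — then `i` is an isomorphism of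
`Spec R`-schemes (`Over.forget` reflects isomorphisms). [cite: GortzWedhorn2020, Prop. 3.35]
[cite: Hartshorne1977, Ch. II, Prop. 5.9 (p. 116)] -/
theorem isIso_of_isClosedImmersion_left_of_forall_isClosed_factor
    {R : CommRingCat.{u}} [IsNoetherianRing R] [IsJacobsonRing R] {Γ' T' : Over (Spec R)} (i' : Γ' ⟶ T')
    [LocallyOfFiniteType T'.hom] [IsClosedImmersion i'.left]
    (h : ∀ (t : T'.left), IsClosed ({t} : Set T'.left) → ∀ (n : ℕ),
      ∃ s : Spec (.of (↑(T'.left.presheaf.stalk t) ⧸ maximalIdeal ↑(T'.left.presheaf.stalk t) ^ (n + 1))) ⟶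
          Γ'.left,
        s ≫ i'.left = Spec.map (CommRingCat.ofHom (Ideal.Quotient.mk
          (maximalIdeal ↑(T'.left.presheaf.stalk t) ^ (n + 1)))) ≫ T'.left.fromSpecStalk t) :
    IsIso i' :=
  haveI : IsIso ((Over.forget (Spec R)).map i') := by
    rw [Over.forget_map]
    exact isIso_of_isClosedImmersion_of_forall_isClosed_factor_of_locallyOfFiniteType i'.left T'.hom h
  isIso_of_reflects_iso i' (Over.forget (Spec R))

end Literature.AlgebraicGeometry.Morphisms
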